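import Summits.NavierStokesRegularity.NavierStokesRegularity.Theorems.IntenseSetDoorsDefs
import Summits.NavierStokesRegularity.NavierStokesRegularity.Theorems.IntenseSetDoorsLowStretching
import Summits.NavierStokesRegularity.NavierStokesRegularity.Theorems.IntenseSetDoorsLambPairing
import Summits.NavierStokesRegularity.NavierStokesRegularity.Theorems.IntenseSetDoorsGronwall
import Summits.NavierStokesRegularity.NavierStokesRegularity.Theorems.IntenseSetDoorsMassStretching
import Summits.NavierStokesRegularity.NavierStokesRegularity.Theorems.IntenseSetDoorsMassPower
import Summits.NavierStokesRegularity.NavierStokesRegularity.Theorems.IntenseSetDoorsAssemblyBeltrami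
import Summits.NavierStokesRegularity.NavierStokesRegularity.Theorems.IntenseSetDoorsAssemblyCalm
import Summits.NavierStokesRegularity.NavierStokesRegularity.Theorems.IntenseSetDoorsAssemblyTwist
import Summits.NavierStokesRegularity.NavierStokesRegularity.Theorems.CriticalCoherenceDoorContinuation
import HarnessLib

/-!
# S34 «IntenseSetDoors» — the three doors CLOSED BY NAME

Summits-side closers (theorems only) for door family S34 of the `NoTypeII` door programme (nsreg-p1 g28,
ROUND-32; texts of record `r32/Sketch34.lean` c542dddc314f2f7c = tree P0 `Theorems/IntenseSetDoorsDefs.lean`,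
p640782). Each door is the kernel-checked composition of P0 (`…_of_plates`) applied to the landed plates:

* door C `criticalMassDoor_holds : CriticalMassDoor` := `criticalMassDoor_of_plates` T34C
  (`criticalMassStretching_holds`, p641880) G34 (`forcedPowerGronwallSlab_holds`, p641386) A34-C
  (`criticalMassPowerBoundAssembly_holds`, p642118) P2 (`subcriticalEnstrophyContinuation_holds`, p637832);
* door B `beltramiCoreDoor_holds : BeltramiCoreDoor` := `beltramiCoreDoor_of_plates` V34
  (`valueCutoffLowStretching_holds`, p641194) L34 (`lambPairingBound_holds`, p641463) G34 A34-B
  (`beltramiCorePowerBoundAssembly_holds`, p642321) P2;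
* door A `criticalCalmDoor_holds : CriticalCalmDoor` := `criticalCalmDoor_of_plates` V34 L34 G34 A34-A
  (`criticalCalmPowerBoundAssembly_holds`) P2.

HONEST FRAME: three regularity CRITERIA on the scale-critical intense set `S_t = {(T − t)|ω| > ε₀}`
(calm / aligned / light core ⇒ continuation past `T`), Type-II-inclusive, UNCONDITIONAL (no named-fact
hypothesis); item 0056 `NoTypeII` and NS regularity are NOT proved by this.
-/

noncomputable section

set_option linter.dupNamespace false

open Summit.NavierStokesRegularity.NavierStokesRegularity.Theorems.CriticalCoherenceDoor
  (subcriticalEnstrophyContinuation_holds)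

namespace Summit.NavierStokesRegularity.NavierStokesRegularity.Theorems.IntenseSetDoors

/-- **Door S34-C «CriticalMassDoor» CLOSED BY NAME** (T34C + G34 + A34-C + S33's P2). [folklore] -/
theorem criticalMassDoor_holds : CriticalMassDoor :=
  criticalMassDoor_of_plates criticalMassStretching_holds forcedPowerGronwallSlab_holds
    criticalMassPowerBoundAssembly_holds subcriticalEnstrophyContinuation_holds

/-- **Door S34-B «BeltramiCoreDoor» CLOSED BY NAME** (V34 + L34 + G34 + A34-B + S33's P2). [folklore] -/
theorem beltramiCoreDoor_holds : BeltramiCoreDoor :=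
  beltramiCoreDoor_of_plates valueCutoffLowStretching_holds lambPairingBound_holds
    forcedPowerGronwallSlab_holds beltramiCorePowerBoundAssembly_holds
    subcriticalEnstrophyContinuation_holds

/-- **Door S34-A «CriticalCalmDoor» CLOSED BY NAME** (V34 + L34 + G34 + A34-A + S33's P2). [folklore] -/
theorem criticalCalmDoor_holds : CriticalCalmDoor :=
  criticalCalmDoor_of_plates valueCutoffLowStretching_holds lambPairingBound_holds
    forcedPowerGronwallSlab_holds criticalCalmPowerBoundAssembly_holds
    subcriticalEnstrophyContinuation_holds

/-- **Door S34-D «CriticalTwistDoor» CLOSED BY NAME** (V34 + L34 + G34 + A34-D + S33's P2; APPEND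
2026-08-28, LEAD ns-s30-p1 g3; texts `Theorems/IntenseSetDoorsTwistDefs.lean` = the LEAD's draft adopted verbatim
by the planner of record nsreg-p1 g29; door D: small critical perpendicular-to-`u` vorticity on the intense
core ⇒ continuation). [folklore] -/
theorem criticalTwistDoor_holds : CriticalTwistDoor :=
  criticalTwistDoor_of_plates valueCutoffLowStretching_holds lambPairingBound_holds
    forcedPowerGronwallSlab_holds criticalTwistPowerBoundAssembly_holds
    subcriticalEnstrophyContinuation_holds

end Summit.NavierStokesRegularity.NavierStokesRegularity.Theorems.IntenseSetDoors

end
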